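import Mathlib
import Summits.ResolutionOfSingularities.ResolutionOfSingularities.Theorems.RadicialJungCleanModelsCleanProp44TransferUnramified
import HarnessLib

/-!
# Route `RadicialJung`, crux `CleanModels` (stmt-ResolutionOfSingularities-15917), line `Sketch` rev 35, stub 6 `stub_cleanProp44` (X44c):
# THE LOCAL RING OF THE EXCEPTIONAL CHART AT A POINT OF THE SECTION `Γ″` — «same residue field» and «`P` uniformizes `K`» (inputs of ✓ `descent_at_birth_of_unramified`), def-free

Seat decomp-res-hand-2 g21 (structural hand).  ✓ `descent_at_birth_of_unramified` (`…TransferUnramified`) asks, at a birth `c′ ∈ Γ″ = V(T + λ(u))` of the exceptional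
chart `𝔸²_{κ(c)} = Spec κ[u][T]` lying over the closed point `P` of the base line: (res) every residue class of `𝒪_{K,c′} = S/I` is a polynomial in `u`, and
(unif) `P` generates the maximal ideal of `S/I`.  Memo 4e §2.5 takes both for granted («`Γ″ ≅ Z_{δ−2} ≅ ℙ¹_{κ(c)}`»; `K = L′_rep ∩ E` is the graph
`v(c)·t_m = (γ − g)^p`).  THIS FILE derives them from the three standard facts about the local ring `S = 𝒪_{E,c′} = κ[u][T]_{𝔫₀}`, `𝔫₀ = (P, T + λ)` (outputs of
`IsLocalization.AtPrime`, stated as hypotheses so that no primality of `𝔫₀` has to be supplied here): `𝔫_S = 𝔫₀S`, `𝔫_S ∩ κ[u][T] = 𝔫₀`, and every element of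
`S` is a fraction `f/s` with `s ∉ 𝔫₀`:

* `eval_mem_span_of_mem_span_pair` — the dictionary `𝔫₀ ∩ κ[u] = (P)` via `T ↦ −λ`; `sub_C_eval_mem_span_pair` — `f ≡ f(u, −λ) (mod 𝔫₀)`.
* `exists_sub_algebraMap_C_mem_maximalIdeal` — **(res) for `S`**: every `z ∈ S` is `≡` a polynomial `g(u)` modulo `𝔫_S` (the point `c′` of the SECTION `Γ″` has
  residue field `κ[u]/(P)`); `exists_sub_map_mem_maximalIdeal_quotient` — the same in `S/I`.
* `maximalIdeal_quotient_eq_span_of_newLeaf` — **(unif)**: if `I ∋ w = a₀·T − G^p` with `a₀ ≠ 0` (the new leaf representative on `E`; `p = char`), `I ≤ 𝔫_S`, and `S/I`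
  is a DVR (the curve `K` is regular at `c′`), then `𝔫_{S/I} = (P̄)`: modulo `𝔫_S²`, `G^p ≡ g₀(u)^p` is a polynomial in `u`, so `a₀(T + λ) ≡ w + (`polynomial in
  `u` vanishing at `P)`, and Nakayama removes `T + λ` from the generators of `𝔫̄`.
* `descent_at_birth_of_sectionPoint` — ✓ `descent_at_birth_of_unramified` with (res)/(unif) discharged: the remaining scheme-side inputs at a birth are the
  localization facts, `I ∋ w`, `S/I` a DVR, and the surrogate read along `K`.

Honest framing: OURS, elementary local algebra; identifying `𝒪_{E,c′}` with `κ(c)[u][T]_{(P, T+λ)}` through the tower is census (S); nothing here proves X44c, any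
case of `CleanModels`, or resolution of singularities in characteristic `p`. [cite: Matsumura1987, Thm. 11.1–11.2; §8 (Nakayama)] [cite: CossartPiltant2008, Prop. 4.4 (proof, p. 11)]
-/

noncomputable section

set_option linter.dupNamespace false -- mandated namespace of this single-conjunct summit

open Polynomial IsLocalRing

namespace Summit.ResolutionOfSingularities.ResolutionOfSingularities.Theorems.RadicialJung.CleanModels

section SectionPoint

variable {k : Type*} [Field k] (P lam : k[X])

/-- **`𝔫₀ ∩ κ[u] ⊆ (P)` through `T ↦ −λ`**: every element of `𝔫₀ = (P, T + λ) ⊂ κ[u][T]` evaluates at `T = −λ` into `(P)`. [folklore] -/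
theorem eval_mem_span_of_mem_span_pair {f : (k[X])[X]} (hf : f ∈ Ideal.span ({C P, X + C lam} : Set (k[X])[X])) :
    f.eval (-lam) ∈ Ideal.span {P} := by
  obtain ⟨a, b, rfl⟩ := Ideal.mem_span_pair.mp hf
  simp only [eval_add, eval_mul, eval_C, eval_X, neg_add_cancel, mul_zero, add_zero]
  exact Ideal.mul_mem_left _ _ (Ideal.mem_span_singleton_self P)

/-- **`f ≡ f(u, −λ) (mod 𝔫₀)`**: `f − C(f(−λ)) ∈ (T + λ) ⊆ 𝔫₀`. [folklore] -/
theorem sub_C_eval_mem_span_pair (f : (k[X])[X]) :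
    f - C (f.eval (-lam)) ∈ Ideal.span ({C P, X + C lam} : Set (k[X])[X]) := by
  have h1 : X + C lam ∣ f - C (f.eval (-lam)) := by
    have := X_sub_C_dvd_sub_C_eval (p := f) (a := -lam)
    rwa [C_neg, sub_neg_eq_add] at this
  obtain ⟨q, hq⟩ := h1
  rw [hq]
  exact Ideal.mul_mem_right _ _ (Ideal.subset_span (by simp))

variable {S : Type*} [CommRing S] [Algebra (k[X])[X] S] [IsLocalRing S]

/-- **(res) for `S`: the residue field of `c′ ∈ Γ″` is `κ[u]/(P)`.**  If `𝔫_S ⊇ 𝔫₀S` and every `z ∈ S` is a fraction `f/s` (`s ∉ 𝔫₀`), then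
every `z ∈ S` is congruent modulo `𝔫_S` to (the image of) a polynomial `g(u)`. [folklore] -/
theorem exists_sub_algebraMap_C_mem_maximalIdeal (hP : Prime P)
    (h𝔫 : (Ideal.span ({C P, X + C lam} : Set (k[X])[X])).map (algebraMap (k[X])[X] S) ≤ maximalIdeal S)
    (hsurj : ∀ z : S, ∃ f s : (k[X])[X], s ∉ Ideal.span ({C P, X + C lam} : Set (k[X])[X]) ∧
      z * algebraMap (k[X])[X] S s = algebraMap (k[X])[X] S f)
    (z : S) : ∃ g : k[X], z - algebraMap (k[X])[X] S (C g) ∈ maximalIdeal S := by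
  set ι := algebraMap (k[X])[X] S with hι
  have hι𝔫 : ∀ f ∈ Ideal.span ({C P, X + C lam} : Set (k[X])[X]), ι f ∈ maximalIdeal S :=
    fun f hf => h𝔫 (Ideal.mem_map_of_mem _ hf)
  obtain ⟨f, s, hs, hz⟩ := hsurj z
  -- `s ≡ s₁(u)`, `s₁ ∉ (P)`, so `s₁` is invertible modulo `P`
  set s₁ := s.eval (-lam) with hs₁
  have hs₁P : s₁ ∉ Ideal.span {P} := by
    intro h1
    apply hs
    have h2 : s = (s - C s₁) + C s₁ := by ring
    rw [h2]
    refine Ideal.add_mem _ (sub_C_eval_mem_span_pair P lam s) ?_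
    obtain ⟨q, hq⟩ := Ideal.mem_span_singleton.mp h1
    rw [hq, C_mul]
    exact Ideal.mul_mem_right _ _ (Ideal.subset_span (by simp))
  haveI : (Ideal.span {P}).IsPrime := (Ideal.span_singleton_prime hP.ne_zero).mpr hP
  have hmax : (Ideal.span {P}).IsMaximal :=
    IsPrime.to_maximal_ideal (by rw [Ne, Ideal.span_singleton_eq_bot]; exact hP.ne_zero)
  obtain ⟨s₂, i, hi, hinv⟩ := hmax.exists_inv hs₁P
  refine ⟨f.eval (-lam) * s₂, ?_⟩
  -- `z − ι C(f₁ s₂) = z·ι(C i) + z·ι(C s₂)·ι(C s₁ − s) + ι(C s₂)·ι(f − C f₁)` modulo signs, each in `𝔫_S`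
  have key : z - ι (C (f.eval (-lam) * s₂)) =
      z * ι (C i) + z * ι (C s₂) * ι (C s₁ - s) + ι (C s₂) * (ι s * z - ι (C (f.eval (-lam)))) := by
    have h3 : ι (C s₂) * ι (C s₁) + ι (C i) = 1 := by
      rw [← map_mul, ← map_add, ← C_mul, ← C_add, hinv, C_1, map_one]
    have h4 : z = z * (ι (C s₂) * ι (C s₁) + ι (C i)) := by rw [h3, mul_one]
    rw [map_mul (C : k[X] →+* (k[X])[X]), map_mul ι, map_sub]
    conv_lhs => rw [h4]
    ring
  rw [key]
  refine Ideal.add_mem _ (Ideal.add_mem _ ?_ ?_) ?_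
  · refine Ideal.mul_mem_left _ _ (hι𝔫 _ ?_)
    obtain ⟨q, hq⟩ := Ideal.mem_span_singleton.mp hi
    rw [hq, C_mul]
    exact Ideal.mul_mem_right _ _ (Ideal.subset_span (by simp))
  · refine Ideal.mul_mem_left _ _ (hι𝔫 _ ?_)
    have := sub_C_eval_mem_span_pair P lam s
    rw [← neg_sub]
    exact Submodule.neg_mem _ this
  · refine Ideal.mul_mem_left _ _ ?_
    rw [mul_comm, hz, ← map_sub]
    exact hι𝔫 _ (sub_C_eval_mem_span_pair P lam f)

/-- **(res) in `S/I`** — hypothesis `hres` of ✓ `descent_at_birth_of_unramified`. [folklore] -/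
theorem exists_sub_map_mem_maximalIdeal_quotient (hP : Prime P)
    (h𝔫 : (Ideal.span ({C P, X + C lam} : Set (k[X])[X])).map (algebraMap (k[X])[X] S) ≤ maximalIdeal S)
    (hsurj : ∀ z : S, ∃ f s : (k[X])[X], s ∉ Ideal.span ({C P, X + C lam} : Set (k[X])[X]) ∧
      z * algebraMap (k[X])[X] S s = algebraMap (k[X])[X] S f)
    (I : Ideal S) [I.IsPrime] [IsDiscreteValuationRing (S ⧸ I)] (hI : I ≤ maximalIdeal S) (y : S ⧸ I) :
    ∃ g : k[X], y - ((Ideal.Quotient.mk I).comp ((algebraMap (k[X])[X] S).comp C)) g ∈ maximalIdeal (S ⧸ I) := by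
  obtain ⟨z, rfl⟩ := Ideal.Quotient.mk_surjective y
  obtain ⟨g, hg⟩ := exists_sub_algebraMap_C_mem_maximalIdeal P lam hP h𝔫 hsurj z
  refine ⟨g, ?_⟩
  rw [← map_mk_eq_maximalIdeal_of_isMaximal I (maximalIdeal S) hI]
  rw [RingHom.comp_apply, RingHom.comp_apply, ← map_sub]
  exact Ideal.mem_map_of_mem _ hg

/-- **(unif) `P` uniformizes `K` at `c′`** — hypothesis `hunif` of ✓ `descent_at_birth_of_unramified`.  With `S` as above (`𝔫_S = 𝔫₀S`), Noetherian of
characteristic `p`, the curve ideal `I ≤ 𝔫_S` with `S/I` a DVR containing the new leaf `w = a₀·T − G^p` (`a₀ ≠ 0`): `𝔫_{S/I} = (P̄)`.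
[cite: Matsumura1987, §8 (Nakayama), Thm. 11.1] -/
theorem maximalIdeal_quotient_eq_span_of_newLeaf [IsNoetherianRing S] (p : ℕ) [hp : Fact p.Prime] [CharP S p] (hP : Prime P)
    (h𝔫eq : maximalIdeal S = (Ideal.span ({C P, X + C lam} : Set (k[X])[X])).map (algebraMap (k[X])[X] S))
    (hcomap : (maximalIdeal S).comap (algebraMap (k[X])[X] S) ≤ Ideal.span ({C P, X + C lam} : Set (k[X])[X]))
    (hsurj : ∀ z : S, ∃ f s : (k[X])[X], s ∉ Ideal.span ({C P, X + C lam} : Set (k[X])[X]) ∧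
      z * algebraMap (k[X])[X] S s = algebraMap (k[X])[X] S f)
    (I : Ideal S) [I.IsPrime] [IsDiscreteValuationRing (S ⧸ I)] (hI : I ≤ maximalIdeal S) {a₀ : k} (ha₀ : a₀ ≠ 0) {G : S}
    (hw : algebraMap (k[X])[X] S (C (C a₀) * X) - G ^ p ∈ I) :
    maximalIdeal (S ⧸ I) = Ideal.span {((Ideal.Quotient.mk I).comp ((algebraMap (k[X])[X] S).comp C)) P} := by
  set ι := algebraMap (k[X])[X] S with hι
  set x := ι (C P) with hx
  set yy := ι (X + C lam) with hyy
  have h𝔫 : (Ideal.span ({C P, X + C lam} : Set (k[X])[X])).map ι ≤ maximalIdeal S := h𝔫eq.symm.le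
  have h𝔫xy : maximalIdeal S = Ideal.span ({x, yy} : Set S) := by
    rw [h𝔫eq, Ideal.map_span, Set.image_pair]
  have hx𝔫 : x ∈ maximalIdeal S := by rw [h𝔫xy]; exact Ideal.subset_span (by simp)
  have hy𝔫 : yy ∈ maximalIdeal S := by rw [h𝔫xy]; exact Ideal.subset_span (by simp)
  -- `G ≡ g₀(u) (mod 𝔫)`, hence `G^p ≡ g₀^p (mod 𝔫²)`
  obtain ⟨g₀, hg₀⟩ := exists_sub_algebraMap_C_mem_maximalIdeal P lam hP h𝔫 hsurj G
  have hp1 : p = (p - 2) + 2 := (Nat.sub_add_cancel hp.out.two_le).symm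
  have hGp : G ^ p - ι (C (g₀ ^ p)) ∈ maximalIdeal S ^ 2 := by
    rw [map_pow, map_pow, ← sub_pow_char G (ι (C g₀)), hp1, pow_add]
    exact Ideal.mul_mem_left _ _ (Ideal.pow_mem_pow hg₀ 2)
  -- `h := a₀ λ + g₀^p ∈ κ[u]` has `ι(C h) ∈ 𝔫`, hence `h ∈ (P)`: `h = P h₁`
  set h := C a₀ * lam + g₀ ^ p with hh
  have hιh : ι (C h) = (ι (C (C a₀)) * yy - (ι (C (C a₀) * X) - G ^ p)) - (G ^ p - ι (C (g₀ ^ p))) := by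
    simp only [hh, hyy, map_add, map_mul]
    ring
  have hιh𝔫 : ι (C h) ∈ maximalIdeal S := by
    rw [hιh]
    refine Ideal.sub_mem _ (Ideal.sub_mem _ (Ideal.mul_mem_left _ _ hy𝔫) (hI hw)) ?_
    exact Ideal.pow_le_self two_ne_zero hGp
  have hhP : h ∈ Ideal.span {P} := by
    have h1 : C h ∈ Ideal.span ({C P, X + C lam} : Set (k[X])[X]) := hcomap (by rw [Ideal.mem_comap]; exact hιh𝔫)
    have h2 := eval_mem_span_of_mem_span_pair P lam h1
    rwa [eval_C] at h2
  obtain ⟨h₁, hh₁⟩ := Ideal.mem_span_singleton'.mp hhP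
  -- `a₀·yy = w + x·ι(C h₁) + (𝔫²-term)`
  have hyeq : ι (C (C a₀)) * yy = (ι (C (C a₀) * X) - G ^ p) + x * ι (C h₁) + (G ^ p - ι (C (g₀ ^ p))) := by
    have h3 : x * ι (C h₁) = ι (C h) := by rw [hx, ← map_mul, ← map_mul, ← hh₁, mul_comm]
    rw [h3, hιh]; ring
  -- read in `S/I`
  set mk := Ideal.Quotient.mk I with hmk
  have h𝔫bar : maximalIdeal (S ⧸ I) = (maximalIdeal S).map mk :=
    (map_mk_eq_maximalIdeal_of_isMaximal I (maximalIdeal S) hI).symm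
  have ha₀u : IsUnit (mk (ι (C (C a₀)))) := (((isUnit_iff_ne_zero.mpr ha₀).map C).map C).map ι |>.map mk
  have hybar : mk yy ∈ Ideal.span {mk x} ⊔ maximalIdeal (S ⧸ I) ^ 2 := by
    have h4 : mk (ι (C (C a₀))) * mk yy ∈ Ideal.span {mk x} ⊔ maximalIdeal (S ⧸ I) ^ 2 := by
      rw [← map_mul, hyeq, map_add, map_add, Ideal.Quotient.eq_zero_iff_mem.mpr hw, zero_add, map_mul]
      refine Ideal.add_mem _ (Ideal.mem_sup_left (Ideal.mul_mem_right _ _ (Ideal.mem_span_singleton_self _))) ?_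
      refine Ideal.mem_sup_right ?_
      rw [h𝔫bar, ← Ideal.map_pow]
      exact Ideal.mem_map_of_mem _ hGp
    obtain ⟨u, hu⟩ := ha₀u
    have h5 : mk yy = ↑u⁻¹ * (mk (ι (C (C a₀))) * mk yy) := by rw [← hu, ← mul_assoc, Units.inv_mul, one_mul]
    rw [h5]
    exact Ideal.mul_mem_left _ _ h4
  -- Nakayama: `𝔫̄ = (x̄, ȳ) ≤ (x̄) + 𝔫̄² ⟹ 𝔫̄ ≤ (x̄)`
  have hgen : maximalIdeal (S ⧸ I) = Ideal.span ({mk x, mk yy} : Set (S ⧸ I)) := by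
    rw [h𝔫bar, h𝔫xy, Ideal.map_span, Set.image_pair]
  have hle : maximalIdeal (S ⧸ I) ≤ Ideal.span {mk x} ⊔ maximalIdeal (S ⧸ I) • maximalIdeal (S ⧸ I) := by
    rw [smul_eq_mul, ← pow_two]
    conv_lhs => rw [hgen]
    rw [Ideal.span_le, Set.insert_subset_iff, Set.singleton_subset_iff]
    exact ⟨Ideal.mem_sup_left (Ideal.mem_span_singleton_self _), hybar⟩
  have hfg : (maximalIdeal (S ⧸ I)).FG := (isNoetherianRing_iff_ideal_fg _).mp inferInstance _
  have hnak := Submodule.le_of_le_smul_of_le_jacobson_bot hfg (maximalIdeal_le_jacobson ⊥) hle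
  apply le_antisymm hnak
  rw [Ideal.span_singleton_le_iff_mem, h𝔫bar]
  exact Ideal.mem_map_of_mem _ hx𝔫

/-- **THE DESCENT AT ONE BIRTH from the chart structure at `c′`** — ✓ `descent_at_birth_of_unramified` with (res)/(unif) discharged by the two theorems above:
the remaining inputs at a birth `c′ ∈ Γ″` over `P` are the localization facts for `S = 𝒪_{E,c′}` at `𝔫₀ = (P, T + λ)`, the curve ideal `I ∋ a₀T − G^p` with
`S/I` a DVR, and the surrogate «`δ′ ≥ d′`» read along `K` (`c(T + λ)^μ ∈ I + 𝔫_S^{μd′}`). [cite: CossartPiltant2008, Prop. 4.4 (proof, p. 11)] -/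
theorem descent_at_birth_of_sectionPoint [IsNoetherianRing S] (p : ℕ) [Fact p.Prime] [CharP k p] [CharP S p] (hP : Prime P)
    (h𝔫eq : maximalIdeal S = (Ideal.span ({C P, X + C lam} : Set (k[X])[X])).map (algebraMap (k[X])[X] S))
    (hcomap : (maximalIdeal S).comap (algebraMap (k[X])[X] S) ≤ Ideal.span ({C P, X + C lam} : Set (k[X])[X]))
    (hsurj : ∀ z : S, ∃ f s : (k[X])[X], s ∉ Ideal.span ({C P, X + C lam} : Set (k[X])[X]) ∧
      z * algebraMap (k[X])[X] S s = algebraMap (k[X])[X] S f)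
    (I : Ideal S) [I.IsPrime] [IsDiscreteValuationRing (S ⧸ I)] [CharP (S ⧸ I) p] (hI : I ≤ maximalIdeal S)
    {c : k} (hc : c ≠ 0) {a₀ : k} (ha₀ : a₀ ≠ 0) {μ d' : ℕ} (hμ : 0 < μ) {G : S}
    (hw : algebraMap (k[X])[X] S (C (C a₀) * X) - G ^ p ∈ I)
    (hf : algebraMap (k[X])[X] S (C (C c) * (X + C lam) ^ μ) ∈ I ⊔ maximalIdeal S ^ (μ * d')) :
    ∃ g : k[X], C (-a₀) * lam * 1 ^ p + (-g) ^ p ∈ Ideal.span {P} ^ d' :=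
  descent_at_birth_of_unramified I (maximalIdeal S) hI p hc a₀ lam hμ hw hf hP
    (maximalIdeal_quotient_eq_span_of_newLeaf P lam p hP h𝔫eq hcomap hsurj I hI ha₀ hw)
    (exists_sub_map_mem_maximalIdeal_quotient P lam hP h𝔫eq.symm.le hsurj I hI)

end SectionPoint

end Summit.ResolutionOfSingularities.ResolutionOfSingularities.Theorems.RadicialJung.CleanModels

end
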